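import Literature.AnabelianGeometry.EtaleTheta.BiKummerThm44Sub

/-!
# [EtTh] Def. 4.1 (ii): the Galois surjections `Π^tp_X ↠ Aut_D(A^bs)` — conjugation law (PROVED), the
# NATURALITY law in field shape (outer form), and Thm. 4.4 (i) clause 3 ⇒ T44-L09c `GaloisCompatible`

S. Mochizuki, *The étale theta function and its Frobenioid-theoretic manifestations*, Publ. RIMS **45**
(2009) [MochizukiEtTh2009], §4, Def. 4.1 (ii), PDF p. 87 (printed p. 313): "the natural surjective outer
homomorphism `Π^tp_X ↠ Aut_D(A^bs)`" for a Galois object `A^bs` of `D = B^temp(Π^tp_X)⁰[𝒟]`, and Thm. 4.4 (i)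
p. 94: "`Ψ^bs` induces an isomorphism `H_{⊙,1} ≅ H_{⊙,2}`, which is well-defined up to composition with inner
automorphisms of `Π^tp_{X_i}`" [cite: MochizukiEtTh2009, Def 4.1 p.313 (PDF p.87)].

abc-iut cell, layer L2, ROW «galoisSurj NATURALITY cluster at the canonical model» (abc-iut-L2-lead,
2026-08-26T02:54:52Z; seat abc-iut-w5-d013 gen 2; sub-DAG leaves `plan/L2/SUBDAG-EtTh-Thm44.md` T44-L09c and
`SUBDAG-EtTh-Thm56.md` T56-L09c).  PROOF-SIDE companion of abc-iut-L2-t3's `BiKummerSetting`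
(`BiKummer.lean`: the field `galoisSurj : ∀ A, IsGaloisObj A → (Π →* Aut A)` is ONE representative of the
printed OUTER homomorphism, per Galois object, with no naturality law — abc-iut-L6-t12's note F2) and of
abc-iut-w5-d235/L2 sub-DAG file `BiKummerThm44Sub.lean` (T44-L09c `Thm44Hyp.GaloisCompatible`).

WHAT IS HERE (nothing of [EtTh] is asserted; no new named fact):
* `BiKummerSetting.galoisSurj_conj` — PROVED for EVERY setting: conjugation by an automorphism
  `σ ∈ Aut_D(A^bs)` acts on the representative `Π ↠ Aut_D(A^bs)` through an INNER automorphism of `Π`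
  (because the representative is surjective: `σ = galoisSurj x`).  This is the «compatibility with conjugation /
  base automorphisms» half of the cluster; it needs no new field.
* the NATURALITY law in FIELD SHAPE, carried as an explicit HYPOTHESIS BINDER `hS` of the exact type of the
  field `galoisSurj_natural` planned for `BiKummerSetting` (abc-iut-L2-t3's v-bump; TODO-merge(abc-iut-L3-t2);
  this file declares NO `Prop`-valued definition — D-0067 (5)): along every base morphism `b : B → A` between
  Galois objects the two representatives agree UP TO AN INNER AUTOMORPHISM of `Π` (one element `c ∈ Π` per
  morphism `b`).  The STRICT form (`c = 1`) is FALSE at the genuine temperoid `B^temp(Π)` as soon as some `Π/N`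
  is non-abelian (take `b` = a right translation of `Π/N`), so the printed word "outer" is exactly what must be
  typed; every consumer below is insensitive to the inner ambiguity because `H_⊙` is NORMAL.
* consequences of `hS`: `conjAut_eq_of_natural`, `map_conjAut_eq_of_natural` (for an isomorphism `e : B ≅ A` of
  Galois objects and a normal `N ⊆ Π`, transporting `galoisSurj_B(N)` along `e` gives `galoisSurj_A(N)` on the
  nose), `hAbs_map_conjAut_of_natural`.
* **T44-L09c from Thm. 4.4 (i) clause 3 in the form print states it**: `Thm44Hyp.galoisCompatible_of` — if the
  isomorphism `θ : Π^tp_{X₁} ≅ Π^tp_{X₂}` carrying `H_{⊙,1}` onto `H_{⊙,2}` (T44-L09 `HodotCompatible`) is moreover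
  THE ONE INDUCING `Ψ^bs` at Galois objects — `transportBaseAut_A ∘ galoisSurj₁ = galoisSurj₂ ∘ (inner ∘ θ)`
  ([SemiAnbd] Prop. 3.2 / Thm. A.4, the binder `hT`, outer form) — and `Ψ` preserves Galois objects, then
  `Thm44Hyp.GaloisCompatible h`.  HONEST: T44-L09 as typed (a bare `∃ θ` with `θ(H_{⊙,1}) = H_{⊙,2}`) is too weak
  to imply T44-L09c; `hT` is the missing printed clause "induced by `Ψ^bs`", stated as a named binder.
The MODEL instance (L3's `BTemp Π`: Galois objects `≅ Π/N`, the canonical surjection by right translations,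
the naturality law HOLDS) is the companion `Sec4GaloisSurjNaturalModel.lean`.  Nothing here bears on
[IUTchIII] Cor. 3.12; typed ≠ proved except for the theorems of this file.
-/

noncomputable section

namespace Literature.AnabelianGeometry.EtaleTheta

open CategoryTheory Opposite Literature.AlgebraicGeometry.Frobenioids

namespace BiKummerSetting

universe u₀ v₀ u v w

variable {K : Type u₀} [Field K] {X : SemiGraphs.TemperedArithmeticGroup.{u₀} K} {D₀ : Type u₀}
  [Category.{v₀} D₀] {V : FrdIMonoidStub.{w}} {T : RealifiedDivisorMonoids (D₀ := D₀) V} {D : Type u}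
  [Category.{v} D] {VD : FrdICatStub.{u, v, w} D} (S : BiKummerSetting X T D VD)

/-! ### Conjugation law (PROVED for every setting) -/

/-- **Def. 4.1 (ii), "outer": conjugation by an automorphism of the Galois object acts on the representative
`Π^tp_X ↠ Aut_D(A^bs)` through an INNER automorphism of `Π^tp_X`** — for every `σ ∈ Aut_D(A)` there is `x ∈ Π`
(any preimage of `σ`) with `σ · galoisSurj(g) · σ⁻¹ = galoisSurj(x g x⁻¹)` for all `g`.  PROVED from the
surjectivity field alone. [cite: MochizukiEtTh2009, Def 4.1 p.313 (PDF p.87)] -/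
theorem galoisSurj_conj (A : D) (hA : S.IsGaloisObj A) (σ : Aut A) :
    ∃ x : X.Pi, ∀ g : X.Pi, σ * S.galoisSurj A hA g * σ⁻¹ = S.galoisSurj A hA (x * g * x⁻¹) := by
  obtain ⟨x, hx⟩ := S.galoisSurj_surjective A hA σ
  refine ⟨x, fun g => ?_⟩
  rw [← hx, ← map_mul, ← map_inv, ← map_mul]

/-- The image of a NORMAL subgroup `N ⊆ Π^tp_X` under the representative is normalised by ALL of `Aut_D(A^bs)`
(conjugation-invariance of `galoisSurj(N)`; in particular `H_A^bs = galoisSurj(H_⊙)` is normal in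
`Aut_D(A^bs)`). [cite: MochizukiEtTh2009, Def 4.1 p.313 (PDF p.87)] -/
theorem map_galoisSurj_normal (A : D) (hA : S.IsGaloisObj A) (N : Subgroup X.Pi) [N.Normal] :
    (N.map (S.galoisSurj A hA)).Normal := by
  refine ⟨fun τ hτ σ => ?_⟩
  obtain ⟨n, hn, rfl⟩ := Subgroup.mem_map.1 hτ
  obtain ⟨x, hx⟩ := S.galoisSurj_conj A hA σ
  rw [hx n]
  exact Subgroup.mem_map_of_mem _ (Subgroup.Normal.conj_mem inferInstance n hn x)

/-! ### The naturality law in field shape (outer form), as a hypothesis binder -/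

section Natural

/-- **Def. 4.1 (ii) — NATURALITY of the Galois surjections, OUTER form** — the exact type of the field
`galoisSurj_natural` planned for `BiKummerSetting` (TODO-merge(abc-iut-L3-t2); at `D = B^temp(Π^tp_X)⁰[𝒟]` it is
a theorem, companion file), carried in this section as the hypothesis `hS`: for every morphism `b : B → A` of `D`
between Galois objects there is `c ∈ Π^tp_X` such that `b ∘ galoisSurj_B(g) = galoisSurj_A(c g c⁻¹) ∘ b` for all
`g ∈ Π^tp_X` — the representatives of the printed OUTER homomorphisms are compatible along `b` up to `Inn(c)`.
[cite: MochizukiEtTh2009, Def 4.1 p.313 (PDF p.87)] -/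
theorem conjAut_eq_of_natural
    (hS : ∀ ⦃A B : D⦄ (hA : S.IsGaloisObj A) (hB : S.IsGaloisObj B) (b : B ⟶ A),
      ∃ c : X.Pi, ∀ g : X.Pi, (S.galoisSurj B hB g).hom ≫ b = b ≫ (S.galoisSurj A hA (c * g * c⁻¹)).hom)
    {A B : D} (hA : S.IsGaloisObj A) (hB : S.IsGaloisObj B) (e : B ≅ A) :
    ∃ c : X.Pi, ∀ g : X.Pi, e.conjAut (S.galoisSurj B hB g) = S.galoisSurj A hA (c * g * c⁻¹) := by
  obtain ⟨c, hc⟩ := hS hA hB e.hom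
  refine ⟨c, fun g => Aut.ext ?_⟩
  rw [Iso.conjAut_hom, Iso.conj_apply, Iso.inv_comp_eq]
  exact hc g

/-- **Transport of the image of a NORMAL subgroup along an isomorphism of Galois objects** (under the outer
naturality law `hS`): for `N ⊴ Π^tp_X` (e.g. `N = H_⊙`) and `e : B ≅ A`, `e`-conjugation carries `galoisSurj_B(N)`
onto `galoisSurj_A(N)` ON THE NOSE — the inner ambiguity of the outer homomorphism is invisible on normal
subgroups. [cite: MochizukiEtTh2009, Def 4.1 p.313 (PDF p.87)] -/
theorem map_conjAut_eq_of_natural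
    (hS : ∀ ⦃A B : D⦄ (hA : S.IsGaloisObj A) (hB : S.IsGaloisObj B) (b : B ⟶ A),
      ∃ c : X.Pi, ∀ g : X.Pi, (S.galoisSurj B hB g).hom ≫ b = b ≫ (S.galoisSurj A hA (c * g * c⁻¹)).hom)
    {A B : D} (hA : S.IsGaloisObj A) (hB : S.IsGaloisObj B) (e : B ≅ A) (N : Subgroup X.Pi) [hN : N.Normal] :
    (N.map (S.galoisSurj B hB)).map (e.conjAut : Aut B ≃* Aut A).toMonoidHom = N.map (S.galoisSurj A hA) := by
  obtain ⟨c, hc⟩ := S.conjAut_eq_of_natural hS hA hB e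
  ext τ
  simp only [Subgroup.mem_map, MulEquiv.coe_toMonoidHom, exists_exists_and_eq_and]
  constructor
  · rintro ⟨n, hn, rfl⟩
    exact ⟨c * n * c⁻¹, hN.conj_mem n hn c, (hc n).symm⟩
  · rintro ⟨n, hn, rfl⟩
    refine ⟨c⁻¹ * n * c⁻¹⁻¹, hN.conj_mem n hn c⁻¹, ?_⟩
    rw [hc, inv_inv]
    congr 1
    group

/-- In particular for the Frobenioid-side objects: under the outer naturality law, an isomorphism
`e : B^bs ≅ A^bs` between the bases of two Galois objects `A, B ∈ Ob(C)` carries `H_B^bs` onto `H_A^bs`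
(Def. 4.1 (ii): `H_A^bs :=` the image of the normal open subgroup `H_⊙`). [cite: MochizukiEtTh2009, Def 4.1 p.313 (PDF p.87)] -/
theorem hAbs_map_conjAut_of_natural
    (hS : ∀ ⦃A B : D⦄ (hA : S.IsGaloisObj A) (hB : S.IsGaloisObj B) (b : B ⟶ A),
      ∃ c : X.Pi, ∀ g : X.Pi, (S.galoisSurj B hB g).hom ≫ b = b ≫ (S.galoisSurj A hA (c * g * c⁻¹)).hom)
    (A B : S.C) (hA : S.IsGalois A) (hB : S.IsGalois B) (e : B.base ≅ A.base) :
    (S.HAbs B hB).map (e.conjAut : Aut B.base ≃* Aut A.base).toMonoidHom = S.HAbs A hA := by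
  haveI : S.Hodot.Normal := by unfold Hodot; infer_instance
  exact S.map_conjAut_eq_of_natural hS hA hB e S.Hodot

end Natural

/-! ### Thm. 4.4 (i) clause 3 «induced by Ψ^bs, up to inner automorphisms» ⇒ T44-L09c -/

section Thm44

variable {K' : Type u₀} [Field K'] {X₂ : SemiGraphs.TemperedArithmeticGroup.{u₀} K'} {D₀' : Type u₀}
  [Category.{v₀} D₀'] {T₂ : RealifiedDivisorMonoids (D₀ := D₀') V} {D₂ : Type u} [Category.{v} D₂]
  {VD₂ : FrdICatStub.{u, v, w} D₂} {S₁ : BiKummerSetting X T D VD} {S₂ : BiKummerSetting X₂ T₂ D₂ VD₂}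

/-- **T44-L09c `GaloisCompatible` from Thm. 4.4 (i) clause 3 in its printed form**: given an isomorphism of
topological groups `θ : Π^tp_{X₁} ≅ Π^tp_{X₂}` carrying `H_{⊙,1}` onto `H_{⊙,2}` (T44-L09) which INDUCES `Ψ^bs` at
Galois objects up to inner automorphisms — for every Galois `A ∈ Ob(C₁)`, `Ψ(A)` is Galois and
`transportBaseAut_A (galoisSurj₁(g)) = galoisSurj₂(c · θ(g) · c⁻¹)` for some `c ∈ Π^tp_{X₂}` and all `g`
([SemiAnbd] Prop. 3.2 / Thm. A.4: "`Ψ^bs` induces … well-defined up to composition with inner automorphisms";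
the binders `hG`, `hT`) — `Ψ^bs` carries `H_A^bs` onto `H_{Ψ A}^bs` for every Galois `A` (the inner `c` is
invisible on the NORMAL subgroup `H_{⊙,2}`).  `hT` is an INPUT (the temperoid-theoretic clause of (i), outer
form); nothing asserts it. [cite: MochizukiEtTh2009, Thm 4.4 p.94] -/
theorem Thm44Hyp.galoisCompatible_of (h : Thm44Hyp S₁ S₂) (θ : X.Pi ≃* X₂.Pi)
    (hθ : S₁.Hodot.map θ.toMonoidHom = S₂.Hodot)
    (hG : ∀ (A : S₁.C), S₁.IsGalois A → S₂.IsGalois (h.Ψ.functor.obj A))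
    (hT : ∀ (A : S₁.C) (hA : S₁.IsGalois A), ∃ c : X₂.Pi, ∀ g : X.Pi,
      h.transportBaseAut A (S₁.galoisSurj _ hA g) = S₂.galoisSurj _ (hG A hA) (c * θ g * c⁻¹)) :
    h.GaloisCompatible := by
  intro A hA
  refine ⟨hG A hA, ?_⟩
  obtain ⟨c, hc⟩ := hT A hA
  haveI h2 : S₂.Hodot.Normal := by unfold Hodot; infer_instance
  change (S₁.Hodot.map _).map _ = S₂.Hodot.map _
  rw [Subgroup.map_map]
  ext τ
  simp only [Subgroup.mem_map, MonoidHom.coe_comp, Function.comp_apply]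
  constructor
  · rintro ⟨g, hg, rfl⟩
    refine ⟨c * θ g * c⁻¹, h2.conj_mem _ ?_ c, (hc g).symm⟩
    rw [← hθ]
    exact Subgroup.mem_map_of_mem _ hg
  · rintro ⟨g₂, hg₂, rfl⟩
    have hg₂' : c⁻¹ * g₂ * c⁻¹⁻¹ ∈ S₂.Hodot := h2.conj_mem _ hg₂ c⁻¹
    rw [← hθ] at hg₂'
    obtain ⟨g, hg, hgθ⟩ := Subgroup.mem_map.1 hg₂'
    refine ⟨g, hg, (hc g).trans ?_⟩
    have hθg : θ g = c⁻¹ * g₂ * c⁻¹⁻¹ := hgθ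
    rw [hθg, inv_inv]
    congr 1
    group

end Thm44

end BiKummerSetting

end Literature.AnabelianGeometry.EtaleTheta

end
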